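import Summits.QuantumFields.BalabanUV.Beta.GAN24.CombCubicCellChargeZero
import Summits.QuantumFields.BalabanUV.Beta.ReflectionLocusCombPure
import Summits.QuantumFields.BalabanUV.Beta.SymVhSliceReflectionAn1
import Summits.QuantumFields.BalabanUV.Beta.SymSecondOrderTablesAn1

/-!
# `BalabanUV.Beta.GAN24.CombChartCubicCellChargeZero` — binder row G-an2-4 ∕ (CONV-C), TRANSFER-III, row (C) at levels ≥ 1, THE PARITY ROUTE AT THE (III′) COMB CHART (first half):
# **THE CUBIC CELL CHARGE OF THE COMB-CHART TOWER's PURE FIELD TABLE `SpureCombOf tabs Lc⁴ (−Lc⁸∕2) cΛ j` VANISHES — EVERY LEVEL `j`, EVERY THREE-INDEX PATTERN, AT THE PIN**, for ANY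
# sym record `tabs : SymTables 3 Lc` with the first-order reflection letters (V-r)(V-ff0)(H-r) DISPLAYED, and at an1's record `symTablesAn1S2 3 Lc cΛt` with them DISCHARGED
# (the (III′) twin of road-P2 g48's `CombCubicCellChargeZero.cubicCellCharge_SpureRecAt_eq_zero`; OWNER `b2b-balaban-gan24-p1`, gen 51, sizing memo `gen51/M-ODD-HALF-SIZING-g51.md` M1′)

NOT IN PRINT; OUR BOOKKEEPING ([folklore] composition BY NAME: leaf-02 g47's `ZeroModeReflectionParity.cubicCharge_eq_zero_of_refl_conjV` (generic in the table `S`, the sandwiches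
`𝕄 α`, the diagonal generators `g`) fed with an2's (III′) letters — the pure law `ReflectionLocusCombPure.SpureCombOf_bref_all` (P6-0b; contact `conjV (bhKStepSh 3 Lc (Dsh Lc) j)
(γ_j • diagK (ctGenM 3 (bhK Lc + Dsh Lc) α Lc κ u))`), `CombChartStepJets.locStencil_SpureCombOf ∕ SpureCombOf_translate`, the delta field leg `E3ContactGenerator.ctGenM_inl`; the
sandwich's Ward zeros and summabilities are road-P2's `tsum_bhKStepAt_inl_inl_row ∕ col_eq_zero`, `summable_bhKStepAt_row ∕ col` TRANSFERRED through §1: the ff block of an1's shifted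
spread `bhKStepSh d Lc (Dsh Lc) j` IS that of the rooted step kernel `bhKStepAt d ρ Lc j` (`Dsh_inl_inl = 0`; road FP's `NestedStepLawTorusTransportedRowsGradedSym.bhKStepSh_Dsh_inl_inl_eq_bhKStepAt`,
re-proved here in 6 `rfl`-letter lines for ANY root to keep road FP's torus modules out of GAN24's import cone); at the record: an1's `SymVhSliceReflectionAn1.hVfm_sym ∕ hVmf_sym ∕
hVmm_sym ∕ hHr_sym'` and `SymAveragingHessianCounts.symVhSAt_hV0_ctr`; 0 `def`, 0 cited facts, 0 `def … : Prop`, 0 sorry; no existing file touched).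
HONEST FRAMING (cell contract, verbatim): «discharging `BetaPertH` makes Bałaban's UV stability UNCONDITIONAL — a real constructive-QFT result; it is NOT the continuum limit and NOT the
Clay problem.»  HONEST DEPENDENCY (verbatim): «continuum YM on T⁴ ⇐ BetaPertH ∧ nine spine estimates (0/9 proved); BetaPertH ⇐ (D1) ∧ (D4) ∧ CAP+tail; G-an2-4 gates asym, D1 and
NE2/3/4.»
WHAT: §1 `bhKStepSh_Dsh_inl_inl_eq_bhKStepAt`, `tsum_bhKStepSh_Dsh_inl_inl_row_eq_zero ∕ …_col_eq_zero`, `summable_bhKStepSh_Dsh_inl_inl_row ∕ _col` (generic `d`); §2 `mul_ctGenM_inl`;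
§3 **`cubicCellCharge_SpureCombOf_eq_zero`** (any `tabs`, letters displayed) and **`cubicCellCharge_SpureCombOf_an1_eq_zero`** (an1's record, hypotheses `Odd Lc` only).  The pin is
spelled `(Lc⁴, −Lc⁸∕2)` as in the (III′) (C)-campaign (`CombChargeConservationRowLegSym` …); an2's law spells `cVH = −(Lc⁴·½·Lc⁴)` — bridged by `ring`.
WHAT THIS IS NOT: the first of the four pieces of the ODD-CLASS half at (III′) (memo M: M2′ contact defect, M3′ odd classes given the quartic law, M4 the record's quartic table law are
NOT here); asserts NO value; NEVER «G-an2-4 closed» as (CONV-C); NOT D1, NOT `BetaPertH`, NOT continuum, NOT Clay; not in print.  2026-08-27.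
-/

noncomputable section

open Finset
open scoped BigOperators
open Literature.MathematicalPhysics.QuantumFieldTheory
open Literature.MathematicalPhysics.QuantumFieldTheory.Balaban1983to89
open Literature.MathematicalPhysics.QuantumFieldTheory.Balaban1983to89.Beta
open ExpKernelCalculus (MKer shiftK BiLoc Decays)
open OneStepResolventKernel (Fib LocStencil)
open AffineAveraging (Site box toSite)
open AveragingContoursRooted (ctrOff ctrOff_mem_box)
open PolarizationSign (reflSign)
open KernelReflection (refK)
open ResolventReflection (bref Φ)
open BalabanStepJetsSucc (wVH)
open Summit.QuantumFields.BalabanUV.Beta.TameKernelCalculus (Spr)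
open Summit.QuantumFields.BalabanUV.Beta.ChartConjugation (conjV)
open Summit.QuantumFields.BalabanUV.Beta.BorderedHessian (diagK bhK bhKAt bhKAt_inl_inl bhKStepAt bhKStepAt_zero bhKStepAt_succ_inl_inl stepScale bhKStep bhKStep_zero
  bhKStep_succ_inl_inl)
open Summit.QuantumFields.BalabanUV.Beta.VertexReflectionContact (smul_diagK)
open Summit.QuantumFields.BalabanUV.Beta.SymmetrisedStepJets (SymTables)
open Summit.QuantumFields.BalabanUV.Beta.SymShiftedSpread (bhKStepSh bhKStepSh_apply bhKStepSh_zero)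
open Summit.QuantumFields.BalabanUV.Beta.E3ContactGenerator (ctGenM ctGenM_inl)
open Summit.QuantumFields.BalabanUV.Beta.DshAn1 (Dsh Dsh_inl_inl)
open AveragingContoursRooted (ctr)
open Summit.QuantumFields.BalabanUV.Beta.SymAveragingHessianCounts (symVhSAt symHessFFAt symVhSAt_hV0_ctr)
open Summit.QuantumFields.BalabanUV.Beta.CombChartStepJets (SpureCombOf locStencil_SpureCombOf SpureCombOf_translate)
open Summit.QuantumFields.BalabanUV.Beta.ReflectionLocusCombPure (SpureCombOf_bref_all)
open Summit.QuantumFields.BalabanUV.Beta.SymVhSliceReflectionAn1 (hVfm_sym hVmf_sym hVmm_sym hHr_sym')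
open Summit.QuantumFields.BalabanUV.Beta.SymSecondOrderTablesAn1 (symTablesAn1S2 symTablesAn1S2_def)
open Summit.QuantumFields.BalabanUV.Beta.GAN24.KernelLegCharges (summable_prod_of_biLoc summable_right_of_biLoc)
open Summit.QuantumFields.BalabanUV.Beta.GAN24.ZeroModeReflectionParity (cubicCharge_eq_zero_of_refl_conjV)
open Summit.QuantumFields.BalabanUV.Beta.GAN24.CombCubicCellChargeZero (tsum_bhKStepAt_inl_inl_row_eq_zero tsum_bhKStepAt_inl_inl_col_eq_zero summable_bhKStepAt_row
  summable_bhKStepAt_col)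

namespace Summit.QuantumFields.BalabanUV.Beta.GAN24.CombChartCubicCellChargeZero

/-! ## §1 The shifted spread's ff block is the rooted step kernel's: Ward zeros and summabilities transfer (generic `d`, every level) -/

section Sandwich

variable {d : ℕ} {Lc : ℕ} [NeZero Lc]

/-- [folklore] **THE FIELD–FIELD BLOCK OF an1's SHIFTED SPREAD IS THAT OF THE ROOTED STEP KERNEL, AT EVERY LEVEL AND ANY ROOT** (road FP's
`NestedStepLawTorusTransportedRowsGradedSym.bhKStepSh_Dsh_inl_inl_eq_bhKStepAt`, re-proved for any root `ρ`): `Dsh`'s field block vanishes, `bhKAt`'s is `bhK`'s, and both step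
kernels put `wVH · E2` there at `j + 1`. -/
theorem bhKStepSh_Dsh_inl_inl_eq_bhKStepAt (ρ : Fin (d + 1) → ℤ) (j : ℕ) (x z : Fin (d + 1) → ℤ) (a b : Fin (d + 1)) :
    bhKStepSh d Lc (Dsh Lc) j x z (Sum.inl a) (Sum.inl b) = bhKStepAt d ρ Lc j x z (Sum.inl a) (Sum.inl b) := by
  cases j with
  | zero =>
    rw [bhKStepSh_zero, bhKStepAt_zero, bhKAt_inl_inl, Pi.add_apply, Pi.add_apply, Pi.add_apply, Pi.add_apply, Dsh_inl_inl, add_zero]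
  | succ j =>
    rw [bhKStepSh_apply, bhKStepAt_succ_inl_inl, Pi.add_apply, Pi.add_apply, Pi.add_apply, Pi.add_apply, Pi.smul_apply, Pi.smul_apply, Pi.smul_apply,
      Pi.smul_apply, smul_eq_mul, bhKStep_succ_inl_inl, Dsh_inl_inl, mul_zero, add_zero]

/-- [folklore] Row constant modes of the shifted spread's ff block vanish (road-P2's `tsum_bhKStepAt_inl_inl_row_eq_zero` through §1). -/
theorem tsum_bhKStepSh_Dsh_inl_inl_row_eq_zero (j : ℕ) (x : Fin (d + 1) → ℤ) (a b : Fin (d + 1)) :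
    ∑' z, bhKStepSh d Lc (Dsh Lc) j x z (Sum.inl a) (Sum.inl b) = 0 := by
  simp_rw [bhKStepSh_Dsh_inl_inl_eq_bhKStepAt (toSite (ctrOff (d + 1) Lc))]
  exact tsum_bhKStepAt_inl_inl_row_eq_zero _ j x a b

/-- [folklore] Column constant modes vanish too. -/
theorem tsum_bhKStepSh_Dsh_inl_inl_col_eq_zero (j : ℕ) (z : Fin (d + 1) → ℤ) (a b : Fin (d + 1)) :
    ∑' x, bhKStepSh d Lc (Dsh Lc) j x z (Sum.inl a) (Sum.inl b) = 0 := by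
  simp_rw [bhKStepSh_Dsh_inl_inl_eq_bhKStepAt (toSite (ctrOff (d + 1) Lc))]
  exact tsum_bhKStepAt_inl_inl_col_eq_zero _ j z a b

/-- [folklore] ff rows of the shifted spread are summable (in-block centred root; road-P2's `summable_bhKStepAt_row`). -/
theorem summable_bhKStepSh_Dsh_inl_inl_row (hLc : 1 ≤ Lc) (j : ℕ) (x : Fin (d + 1) → ℤ) (a b : Fin (d + 1)) :
    Summable fun z => bhKStepSh d Lc (Dsh Lc) j x z (Sum.inl a) (Sum.inl b) := by
  simp_rw [bhKStepSh_Dsh_inl_inl_eq_bhKStepAt (toSite (ctrOff (d + 1) Lc))]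
  exact summable_bhKStepAt_row (ctrOff_mem_box hLc) j x _ _

/-- [folklore] ff columns of the shifted spread are summable. -/
theorem summable_bhKStepSh_Dsh_inl_inl_col (hLc : 1 ≤ Lc) (j : ℕ) (z : Fin (d + 1) → ℤ) (a b : Fin (d + 1)) :
    Summable fun x => bhKStepSh d Lc (Dsh Lc) j x z (Sum.inl a) (Sum.inl b) := by
  simp_rw [bhKStepSh_Dsh_inl_inl_eq_bhKStepAt (toSite (ctrOff (d + 1) Lc))]
  exact summable_bhKStepAt_col (ctrOff_mem_box hLc) j z _ _

end Sandwich

/-! ## §2 The legged contact generator's field leg -/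

section Leg

variable {Lc : ℕ}

/-- [folklore] The scaled LEGGED product-chart generator's FIELD leg is the same single-site single-component delta as the plain one's (road-P2's `mul_ctGen_inl`):
`(γ·ctGenM B α κ′ u) x (inl β) = [x = u ∧ β = κ′]·(−γ·[κ′ = α])` — the border `B` enters the multiplier leg only. -/
theorem mul_ctGenM_inl (B : MKer 4 (Fib 3)) (γ : ℝ) (α κ' : Fin 4) (u x : Fin 4 → ℤ) (β : Fin 4) :
    γ * ctGenM 3 B α Lc κ' u x (Sum.inl β) = if x = u ∧ β = κ' then (if κ' = α then -γ else 0) else 0 := by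
  rw [ctGenM_inl]
  by_cases h1 : x = u ∧ β = κ'
  · by_cases h2 : κ' = α
    · rw [if_pos ⟨h1.1, h1.2, h2⟩, if_pos h1, if_pos h2, mul_neg, mul_one]
    · rw [if_neg (fun h => h2 h.2.2), if_pos h1, if_neg h2, mul_zero]
  · rw [if_neg (fun h => h1 ⟨h.1, h.2.1⟩), if_neg h1, mul_zero]

end Leg

/-! ## §3 The cubic cell charge of the comb-chart pure member vanishes -/

section Charge

variable {Lc : ℕ} [NeZero Lc]

/-- NOT IN PRINT; OUR BOOKKEEPING.  **THE CUBIC CELL CHARGE OF THE COMB-CHART TOWER's PURE FIELD TABLE VANISHES** — any sym record `tabs : SymTables 3 Lc` whose first-order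
tables obey an1's reflection letters (V-r) (`hVfm hVmf hVmm`, pinned legged contact generator), (V-ff0) `hV0` and (H-r) `hHr`; every level `j`, every three-index pattern
`(κ′; κ₁, κ₂)`, at the pin `(cE, cVH) = (Lc⁴, −Lc⁸∕2)`, ANY `cΛ`. -/
theorem cubicCellCharge_SpureCombOf_eq_zero (hLc : Odd Lc) (tabs : SymTables 3 Lc) (cΛ : ℝ)
    (hVfm : ∀ (α κ' : Fin 4) (u x z : Fin 4 → ℤ) (β μ : Fin 4), tabs.V κ' (bref α κ' u) x z (Sum.inl β) (Sum.inr μ) =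
      (reflSign α κ' • refK (Φ (d := 3) Lc α) (tabs.V κ' u + conjV (bhK (d := 3) Lc + Dsh Lc)
        ((((Lc : ℝ) ^ 4)⁻¹) • diagK (ctGenM 3 (bhK Lc + Dsh Lc) α Lc κ' u)))) x z (Sum.inl β) (Sum.inr μ))
    (hVmf : ∀ (α κ' : Fin 4) (u x z : Fin 4 → ℤ) (μ β : Fin 4), tabs.V κ' (bref α κ' u) x z (Sum.inr μ) (Sum.inl β) =
      (reflSign α κ' • refK (Φ (d := 3) Lc α) (tabs.V κ' u + conjV (bhK (d := 3) Lc + Dsh Lc)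
        ((((Lc : ℝ) ^ 4)⁻¹) • diagK (ctGenM 3 (bhK Lc + Dsh Lc) α Lc κ' u)))) x z (Sum.inr μ) (Sum.inl β))
    (hVmm : ∀ (α κ' : Fin 4) (u x z : Fin 4 → ℤ) (μ μ' : Fin 4), tabs.V κ' (bref α κ' u) x z (Sum.inr μ) (Sum.inr μ') =
      (reflSign α κ' • refK (Φ (d := 3) Lc α) (tabs.V κ' u + conjV (bhK (d := 3) Lc + Dsh Lc)
        ((((Lc : ℝ) ^ 4)⁻¹) • diagK (ctGenM 3 (bhK Lc + Dsh Lc) α Lc κ' u)))) x z (Sum.inr μ) (Sum.inr μ'))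
    (hV0 : ∀ (κ : Fin 4) (w x z : Fin 4 → ℤ) (β β' : Fin 4), tabs.V κ w x z (Sum.inl β) (Sum.inl β') = 0)
    (hHr : ∀ (α' μ : Fin 4) (y : Fin 4 → ℤ), tabs.H μ (bref α' μ y) = reflSign α' μ • refK (Φ (d := 3) Lc α') (tabs.H μ y))
    (j : ℕ) (κ' κ₁ κ₂ : Fin 4) :
    ∑ r ∈ box 4 Lc, ∑' x, ∑' z,
      SpureCombOf tabs ((Lc : ℝ) ^ 4) (-((Lc : ℝ) ^ 8 / 2)) cΛ j κ' (toSite r) x z (Sum.inl κ₁) (Sum.inl κ₂) = 0 := by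
  have hL1 : 1 ≤ Lc := hLc.pos
  have hpin : (-((Lc : ℝ) ^ 8 / 2)) = -((Lc : ℝ) ^ 4 * (1 / 2) * (Lc : ℝ) ^ 4) := by ring
  rw [hpin]
  obtain ⟨Cs, δ, hδ, hS⟩ := locStencil_SpureCombOf tabs ((Lc : ℝ) ^ 4) (-((Lc : ℝ) ^ 4 * (1 / 2) * (Lc : ℝ) ^ 4)) cΛ j
  set γ : ℝ := (-((Lc : ℝ) ^ 4 * (1 / 2) * (Lc : ℝ) ^ 4)) * wVH 3 Lc j / (stepScale 3 Lc j * (Lc : ℝ) ^ 4) with hγ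
  refine cubicCharge_eq_zero_of_refl_conjV (N := Lc) (d := 3)
    (S := SpureCombOf tabs ((Lc : ℝ) ^ 4) (-((Lc : ℝ) ^ 4 * (1 / 2) * (Lc : ℝ) ^ 4)) cΛ j)
    (𝕄 := fun _ => bhKStepSh 3 Lc (Dsh Lc) j)
    (g := fun α κ' u p a => γ * ctGenM 3 (bhK Lc + Dsh Lc) α Lc κ' u p a) (c := fun α κ' => if κ' = α then -γ else 0)
    (SpureCombOf_translate tabs _ _ cΛ j) ?_ ?_
    (fun _ x a b => summable_bhKStepSh_Dsh_inl_inl_row hL1 j x a b) (fun _ z a b => summable_bhKStepSh_Dsh_inl_inl_col hL1 j z a b)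
    (fun _ x a b => tsum_bhKStepSh_Dsh_inl_inl_row_eq_zero j x a b) (fun _ z a b => tsum_bhKStepSh_Dsh_inl_inl_col_eq_zero j z a b)
    (fun κ' u x a b => summable_right_of_biLoc (hS κ' u) hδ _ _ x)
    (fun κ' u a b => (summable_prod_of_biLoc (hS κ' u) hδ (Sum.inl a) (Sum.inl b)).prod) κ' κ₁ κ₂
  · -- an2's (Sr-conj) law of the comb-chart pure member, with the scalar moved inside the diagonal generator
    intro α κ' u
    rw [SpureCombOf_bref_all hLc tabs cΛ (hVfm α) (hVmf α) (hVmm α) hV0 hHr j κ' u, smul_diagK]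
  · -- the delta field leg
    intro α κ' u x β
    exact mul_ctGenM_inl (bhK Lc + Dsh Lc) γ α κ' u x β

/-- NOT IN PRINT; OUR BOOKKEEPING.  **THE SAME AT an1's RECORD `symTablesAn1S2 3 Lc cΛt`, HYPOTHESES `Odd Lc` ONLY**: the five first-order letters are an1's theorems
(`SymVhSliceReflectionAn1.hVfm_sym ∕ hVmf_sym ∕ hVmm_sym ∕ hHr_sym'`, `SymAveragingHessianCounts.symVhSAt_hV0_ctr`; the record's `V ∕ H` are `symVhSAt ρ_c 3 Lc ∕ symHessFFAt ρ_c Lc`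
by `rfl`).  `cΛt` (the record's Λ-table weight) and `cΛ` (the pure member's) are independent here. -/
theorem cubicCellCharge_SpureCombOf_an1_eq_zero (hLc : Odd Lc) (cΛt cΛ : ℝ) (j : ℕ) (κ' κ₁ κ₂ : Fin 4) :
    ∑ r ∈ box 4 Lc, ∑' x, ∑' z,
      SpureCombOf (symTablesAn1S2 3 Lc cΛt) ((Lc : ℝ) ^ 4) (-((Lc : ℝ) ^ 8 / 2)) cΛ j κ' (toSite r) x z (Sum.inl κ₁) (Sum.inl κ₂) = 0 :=
  cubicCellCharge_SpureCombOf_eq_zero hLc (symTablesAn1S2 3 Lc cΛt) cΛ (hVfm_sym hLc) (hVmf_sym hLc) (hVmm_sym hLc)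
    (symVhSAt_hV0_ctr (d := 3) Lc) (hHr_sym' hLc) j κ' κ₁ κ₂

end Charge

end Summit.QuantumFields.BalabanUV.Beta.GAN24.CombChartCubicCellChargeZero

end
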